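import Mathlib
import Summits.Ventures.PercRepro2.HCov
import Summits.Ventures.PercRepro2.TypeRB
import Summits.Ventures.PercRepro2.TypeRBMeanField
import Summits.Ventures.PercRepro2.A3Fibre

/-!
# The between-world covariance of (MEANS-a₃) is the TYPE-RB mean field (blind cell PercRepro2,
typer-1 g57; night-1 g34's pointer of 2026-08-29T17:29:53Z, `proofs/NIGHT1-G34.md` §4)

night-1 g34 splits the means-level form `btw` of (HCOV) (`A3Fibre.btw`, p5 g12) over the three
worlds of `a₃` on `Q = {a₁ ↮ a₂}` — `L = T′ = {a₃ ∈ C(a₁)}` (`TEvent ends a₂ a₁ a₃`),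
`N = PD = {a₃ ∉ U}` (`PDEvent`), `H = T = {a₃ ∈ C(a₂)}` (`TEvent ends a₁ a₂ a₃`) — as
`btw = A + B + C`, with `C = P(Q) · Cov_μ(β̄, φ̄)` the BETWEEN-WORLD covariance of the world means
`β̄_c = E[σ_b | c]`, `φ̄_c = E[F | c]` (weights `m_c / P(Q)`), `F = σ_o + σ₃ (γ − U_o)`, `γ = D_o / D`.
In the masses `S_c = P(c, bL) − P(c, bH) = m_c β̄_c` and `Φ_c = E[F 1_c] = m_c φ̄_c`:

`C = ∑_c S_c Φ_c / m_c − (∑_c S_c)(∑_c Φ_c) / P(Q)`  (`betweenC`).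

This file confirms the pointer in the kernel: `C` IS the type-level mean field
`G_{σ(σ₃)} = Cov_μ(E[σ_b | σ₃], E[F | σ₃])` of TYPE-RB (typer-1 g6, mine-a §19) up to the factor
`P(Q)`, and the cleared identity of record is

* **`betweenC_mul_eq`**: `C · P(Q) P(L) P(N) P(H) = 2 · K`, where `K` (`meanFieldK`) is the
  expression `[P(N,oH) P(L) − P(L,oH) P(N)] P(H) c_L^σ + [P(H,oL) P(N) − P(N,oL) P(H)] P(L) c_H^σ`
  of `TypeRB.meanField_cleared_nonneg` (a rational-function identity: `Qsplit` and `ring`);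
* **`betweenC_nonneg`**: `0 ≤ C` whenever the three worlds have positive mass (so at interior
  weights on every instance where `L, N, H ≠ ∅`) — `C ≥ 0` is the kernel theorem
  `meanField_cleared_nonneg` and nothing else: the comonotonicity of the world means in the order
  `T′ ≥ PD ≥ T` is exactly facts (c), (d′) (`bhk_cross_cluster_avoid` and its root swap), and
  `β̄_{T′} ≥ β̄_{PD} ≥ β̄_T` at the level of `Cov_μ(σ_b, 1_L) ≥ 0 ≥ Cov_μ(σ_b, 1_H)` is facts
  (a), (a′), (b), (b′) (`bhk_same_cluster_events`, `bhk_cross_cluster`); the «Chebyshev on three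
  points» step is the identity itself.

Nothing here bears on `A` or `B` (not sign-definite, night-1 §4) nor on `btw` itself.
-/

namespace Summit.Ventures.PercRepro2

namespace TypeRB

open CovForm

section BetweenWorlds

variable {V : Type*} {E : Type*} [Fintype E] [DecidableEq E] [Fintype V] [DecidableEq V]
  {R : Type*} [Field R] [LinearOrder R] [IsStrictOrderedRing R]

variable (p : E → R) (ends : E → Sym2 V) (o a₁ a₂ a₃ b : V)

/-- The signed `b`-mass of an event `c`: `S_c = P(c, bL) − P(c, bH)` (`= m_c · E[σ_b | c]`). -/
noncomputable def worldSb (c : Set (Config E)) : R :=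
  prob p (c ∩ connEvent ends a₁ b) - prob p (c ∩ connEvent ends a₂ b)

/-- The `F`-mass of a world `c` on which `σ₃ ≡ s`:
`Φ_c = E[F 1_c] = E[σ_o 1_c] + s (γ m_c − P(c, o ∈ U))`, `γ = D_o / D` (`A3Fibre.gamma`). -/
noncomputable def worldSF (c : Set (Config E)) (s : R) : R :=
  (prob p (c ∩ connEvent ends a₁ o) - prob p (c ∩ connEvent ends a₂ o)) +
    s * (A3Fibre.gamma p ends o a₁ a₂ a₃ * prob p c -
      (prob p (c ∩ connEvent ends a₁ o) + prob p (c ∩ connEvent ends a₂ o)))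

/-- **night-1 g34's between-world covariance** `C = P(Q) · Cov_μ(β̄, φ̄)` of the world means of
`σ_b` and `F` over the three worlds `L = T′`, `N = PD`, `H = T` of `a₃` (NIGHT1-G34.md §4,
`btw = A + B + C`): `∑_c S_c Φ_c / m_c − (∑_c S_c)(∑_c Φ_c) / P(Q)` (Lean's `x / 0 = 0` on an
empty world). -/
noncomputable def betweenC : R :=
  worldSb p ends a₁ a₂ b (TEvent ends a₂ a₁ a₃) *
      worldSF p ends o a₁ a₂ a₃ (TEvent ends a₂ a₁ a₃) 1 / prob p (TEvent ends a₂ a₁ a₃) +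
    worldSb p ends a₁ a₂ b (PDEvent ends a₁ a₂ a₃) *
      worldSF p ends o a₁ a₂ a₃ (PDEvent ends a₁ a₂ a₃) 0 / prob p (PDEvent ends a₁ a₂ a₃) +
    worldSb p ends a₁ a₂ b (TEvent ends a₁ a₂ a₃) *
      worldSF p ends o a₁ a₂ a₃ (TEvent ends a₁ a₂ a₃) (-1) / prob p (TEvent ends a₁ a₂ a₃) -
    (worldSb p ends a₁ a₂ b (TEvent ends a₂ a₁ a₃) + worldSb p ends a₁ a₂ b (PDEvent ends a₁ a₂ a₃) +
        worldSb p ends a₁ a₂ b (TEvent ends a₁ a₂ a₃)) *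
      (worldSF p ends o a₁ a₂ a₃ (TEvent ends a₂ a₁ a₃) 1 +
        worldSF p ends o a₁ a₂ a₃ (PDEvent ends a₁ a₂ a₃) 0 +
        worldSF p ends o a₁ a₂ a₃ (TEvent ends a₁ a₂ a₃) (-1)) / prob p (avoidAll ends a₂ {a₁})

/-- The cleared mean field of `TypeRB.meanField_cleared_nonneg`:
`K = [P(N,oH) P(L) − P(L,oH) P(N)] P(H) c_L^σ + [P(H,oL) P(N) − P(N,oL) P(H)] P(L) c_H^σ`,
`c_τ^σ = P(Q) (P(τ,bL) − P(τ,bH)) − P(τ) (P(Q,bL) − P(Q,bH))`. -/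
noncomputable def meanFieldK : R :=
  (prob p (PDEvent ends a₁ a₂ a₃ ∩ connEvent ends a₂ o) * prob p (TEvent ends a₂ a₁ a₃) -
          prob p (TEvent ends a₂ a₁ a₃ ∩ connEvent ends a₂ o) * prob p (PDEvent ends a₁ a₂ a₃)) *
        prob p (TEvent ends a₁ a₂ a₃) *
        (prob p (avoidAll ends a₂ {a₁}) *
            (prob p (TEvent ends a₂ a₁ a₃ ∩ connEvent ends a₁ b) -
              prob p (TEvent ends a₂ a₁ a₃ ∩ connEvent ends a₂ b)) -
          prob p (TEvent ends a₂ a₁ a₃) *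
            (prob p (avoidAll ends a₂ {a₁} ∩ connEvent ends a₁ b) -
              prob p (avoidAll ends a₂ {a₁} ∩ connEvent ends a₂ b))) +
      (prob p (TEvent ends a₁ a₂ a₃ ∩ connEvent ends a₁ o) * prob p (PDEvent ends a₁ a₂ a₃) -
          prob p (PDEvent ends a₁ a₂ a₃ ∩ connEvent ends a₁ o) * prob p (TEvent ends a₁ a₂ a₃)) *
        prob p (TEvent ends a₂ a₁ a₃) *
        (prob p (avoidAll ends a₂ {a₁}) *
            (prob p (TEvent ends a₁ a₂ a₃ ∩ connEvent ends a₁ b) -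
              prob p (TEvent ends a₁ a₂ a₃ ∩ connEvent ends a₂ b)) -
          prob p (TEvent ends a₁ a₂ a₃) *
            (prob p (avoidAll ends a₂ {a₁} ∩ connEvent ends a₁ b) -
              prob p (avoidAll ends a₂ {a₁} ∩ connEvent ends a₂ b)))

/-- `0 ≤ K` is `TypeRB.meanField_cleared_nonneg`. -/
theorem meanFieldK_nonneg (hp : IsProbVec p) : 0 ≤ meanFieldK p ends o a₁ a₂ a₃ b :=
  meanField_cleared_nonneg p ends o a₁ a₂ a₃ b hp

omit [Fintype V] [LinearOrder R] [IsStrictOrderedRing R] in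
/-- **The identity of record**: `C · P(Q) P(L) P(N) P(H) = 2 K` on every instance whose three
worlds have nonzero mass (`Qsplit` in the two `b`-masses and in `P(Q)`, then `ring`). -/
theorem betweenC_mul_eq (hL : prob p (TEvent ends a₂ a₁ a₃) ≠ 0)
    (hN : prob p (PDEvent ends a₁ a₂ a₃) ≠ 0) (hH : prob p (TEvent ends a₁ a₂ a₃) ≠ 0)
    (hQ : prob p (avoidAll ends a₂ {a₁}) ≠ 0) :
    betweenC p ends o a₁ a₂ a₃ b *
        (prob p (avoidAll ends a₂ {a₁}) * prob p (TEvent ends a₂ a₁ a₃) *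
          prob p (PDEvent ends a₁ a₂ a₃) * prob p (TEvent ends a₁ a₂ a₃)) =
      2 * meanFieldK p ends o a₁ a₂ a₃ b := by
  have hbL := Qsplit p ends a₁ a₂ a₃ (connEvent ends a₁ b)
  have hbH := Qsplit p ends a₁ a₂ a₃ (connEvent ends a₂ b)
  have hQs := Qsplit_univ p ends a₁ a₂ a₃
  unfold betweenC worldSb worldSF meanFieldK A3Fibre.gamma Do
  rw [hbL, hbH]
  rw [hQs] at hQ ⊢
  field_simp
  ring

/-- **`C ≥ 0`**: the between-world covariance is nonnegative whenever the three worlds have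
positive mass — it is the kernel theorem `meanField_cleared_nonneg` read through
`betweenC_mul_eq`. -/
theorem betweenC_nonneg (hp : IsProbVec p) (hL : 0 < prob p (TEvent ends a₂ a₁ a₃))
    (hN : 0 < prob p (PDEvent ends a₁ a₂ a₃)) (hH : 0 < prob p (TEvent ends a₁ a₂ a₃)) :
    0 ≤ betweenC p ends o a₁ a₂ a₃ b := by
  have hQ : 0 < prob p (avoidAll ends a₂ {a₁}) := by
    rw [Qsplit_univ p ends a₁ a₂ a₃]
    linarith
  have hid := betweenC_mul_eq p ends o a₁ a₂ a₃ b hL.ne' hN.ne' hH.ne' hQ.ne'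
  have hpos : 0 < prob p (avoidAll ends a₂ {a₁}) * prob p (TEvent ends a₂ a₁ a₃) *
      prob p (PDEvent ends a₁ a₂ a₃) * prob p (TEvent ends a₁ a₂ a₃) := by positivity
  have hK := meanFieldK_nonneg p ends o a₁ a₂ a₃ b hp
  have h2 : 0 ≤ betweenC p ends o a₁ a₂ a₃ b *
      (prob p (avoidAll ends a₂ {a₁}) * prob p (TEvent ends a₂ a₁ a₃) *
        prob p (PDEvent ends a₁ a₂ a₃) * prob p (TEvent ends a₁ a₂ a₃)) := by
    rw [hid]; linarith
  exact (mul_nonneg_iff_of_pos_right hpos).1 h2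

end BetweenWorlds

end TypeRB

end Summit.Ventures.PercRepro2
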